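import Literature.NumberTheory.EllipticCurves.ComplexMultiplicationShaRubinDescentProofs
import Mathlib.Algebra.MonoidAlgebra.Basic
import HarnessLib

/-!
# bsd.S28 (Rubin): level 3 — Kolyvagin's derivative operator (the algebra of §8.2 of Rubin's
Cetraro lectures)

Sibling *proofs* file (theorems only: no definition, no named fact, no instance) for the named
fact `Literature.NumberTheory.EllipticCurves.Rubin1987_sha_primary_finite`
(`ComplexMultiplicationShaRubinProofs.lean`; K. Rubin, Invent. Math. 89 (1987), §10: `Ш(E_K/K)[p^∞]`
is finite when `L(E_K/K, 1) ≠ 0`). In the printed proof the exponent of `Hom(A_n, E_{𝔭ⁿ})^{G_n}`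
(`A_n` the ideal class group of `K_n = K(E_{𝔭ⁿ})`) is bounded by Theorems 8.1 / 9.1 of the paper,
whose method is Thaine's: relations in ideal class groups manufactured from elliptic units. In
Rubin's later exposition of the same theorem (K. Rubin, *Elliptic curves with complex
multiplication and the conjecture of Birch and Swinnerton-Dyer*, LNM 1716 (1999), §§8–9) this
step is organised through **Kolyvagin's Euler systems**: §8.1 the Euler system of elliptic units,
§8.2 *Kolyvagin's derivative construction*, §8.3 the derivative classes `κ_{n,M}(𝔯)` and their
factorisation, §9 the bound on ideal class groups (Thm. 9.5) via the Čebotarev theorem.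

This file proves the algebra of §8.2 on which the derivative construction rests, for an element
`σ` of a monoid `G` with `σ^m = 1` acting on an additive group `X` (printed: `G_𝔮 = ⟨σ_𝔮⟩` cyclic
of order `m = N𝔮 - 1`, Cor. 5.20, acting on the universal Euler system `X_{n,𝔯}` or on
`K_n(𝔯)^×`), with the norm and derivative operators of Definition 8.3,
`N_𝔮 = Σ_{i<m} σ_𝔮^i`, `D_𝔮 = Σ_{i=1}^{N𝔮-2} i σ_𝔮^i = Σ_{i<m} i σ_𝔮^i`, written out as sums (no
definition is introduced):

* `Rubin1987.sub_one_mul_derivative` — the identity of the proof of Prop. 8.4, *"Note that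
  `(σ_𝔮 - 1)D_𝔮 = N𝔮 - 1 - N_𝔮`"*, as an identity `(s - 1)·Σ_{i<m} i s^i = m - Σ_{i<m} s^i` in any
  ring for `s^m = 1`, and `Rubin1987.of_sub_one_mul_derivative`, the same in the group ring
  `ℤ[G]` as printed;
* `Rubin1987.smul_norm_eq`, `Rubin1987.pow_smul_norm_eq` — `σ N_𝔮 x = N_𝔮 x`;
* `Rubin1987.smul_derivative_sub_derivative` — the identity on a `G`-module:
  `σ D_𝔮 x - D_𝔮 x = m·x - N_𝔮 x`;
* `Rubin1987.pow_smul_derivative_sub_derivative_mem` — the inductive step of **Prop. 8.4 (ii)**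
  (*"`D_𝔯 x_{n,𝔯} ∈ (X_{n,𝔯}/M X_{n,𝔯})^{G_𝔯}`"*) in its one-prime form: if `S` is a `σ`-stable
  subgroup containing `m·x` (printed: `M ∣ N𝔮 - 1`) and `N_𝔮 x` (printed: the Euler system
  relation `N_𝔮 x_{n,𝔮𝔰} = (1 - Frob_𝔮^{-1}) x_{n,𝔰}` together with the induction hypothesis), then
  `D_𝔮 x` is fixed by every power of `σ` modulo `S`.

The same identity, with `m = ℓ + 1` and `Tr_ℓ` for `N`, is (3.5) of B. H. Gross, *Kolyvagin's work
on modular elliptic curves* (in: L-functions and Arithmetic, LMS LNS 153 (1991)), §3, and the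
one-prime fixedness is the proof of his Prop. 3.6 (*"It suffices to show that `[D_n y_n]` is
fixed by `σ_ℓ` … `(σ_ℓ - 1) D_n y_n = (ℓ+1) D_m y_n - D_m (Tr_ℓ y_n)`"*), so these theorems serve
the Heegner-point Euler system of `HeegnerPointsKolyvaginEulerSystem.lean` equally.

Not formalised here: the universal Euler system `X_{n,𝔯}` and its freeness (Prop. 8.4 (i),
"[Ru2] Lemma 2.1"), the classes `κ_{n,M}(𝔯)` (Def. 8.7, which needs Hilbert's Theorem 90 for
`K_n(𝔯)/K_n` and Kummer theory) and everything arithmetic (§8.1, §8.3, §9).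

## References

* K. Rubin, *Elliptic curves with complex multiplication and the conjecture of Birch and
  Swinnerton-Dyer*, LNM 1716 (1999): §8.2, Definition 8.3, Proposition 8.4 and its proof.
  [Rubin1999]
* K. Rubin, *Tate–Shafarevich groups and L-functions of elliptic curves with complex
  multiplication*, Invent. Math. 89 (1987): §10 (proof of Thm. A), Thms. 8.1, 9.1. [Rubin1987Sha]
* B. H. Gross, *Kolyvagin's work on modular elliptic curves*, in: L-functions and Arithmetic
  (Durham 1989), LMS Lecture Note Ser. 153 (1991): §3, (3.5) and Prop. 3.6. [GrossLMS1991]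
-/

namespace Literature.NumberTheory.EllipticCurves

namespace Rubin1987

open Finset

/-! ### The identity `(σ - 1) D = m - N` in a ring -/

section Ring

variable {A : Type*} [Ring A]

/-- `s · N = N` for the norm element `N = Σ_{i<m} s^i` of an element `s` with `s^m = 1`.
[cite: Rubin1999, §8.2 (Def. 8.3, proof of Prop. 8.4)] -/
theorem mul_norm_eq {s : A} {m : ℕ} (hs : s ^ m = 1) :
    s * (∑ i ∈ range m, s ^ i) = ∑ i ∈ range m, s ^ i := by
  have h1 : ∑ i ∈ range (m + 1), s ^ i = (∑ i ∈ range m, s ^ (i + 1)) + s ^ 0 :=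
    sum_range_succ' (fun i => s ^ i) m
  have h2 : ∑ i ∈ range (m + 1), s ^ i = (∑ i ∈ range m, s ^ i) + s ^ m :=
    sum_range_succ (fun i => s ^ i) m
  rw [pow_zero] at h1
  rw [hs] at h2
  have h3 : ∑ i ∈ range m, s ^ (i + 1) = ∑ i ∈ range m, s ^ i :=
    add_right_cancel (h1.symm.trans h2)
  rw [mul_sum]
  simp_rw [← pow_succ']
  exact h3

/-- **Kolyvagin's identity `(σ_𝔮 - 1) D_𝔮 = (N𝔮 - 1) - N_𝔮`** in a ring: if `s^m = 1` then
`(s - 1) · Σ_{i<m} i s^i = m - Σ_{i<m} s^i` (Rubin: `s = σ_𝔮`, `m = N𝔮 - 1`,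
`D_𝔮 = Σ_{i=1}^{N𝔮-2} i σ_𝔮^i`; Gross (3.5): `m = ℓ + 1`).
[cite: Rubin1999, §8.2, proof of Prop. 8.4] [cite: GrossLMS1991, §3 (3.5)] -/
theorem sub_one_mul_derivative {s : A} {m : ℕ} (hs : s ^ m = 1) :
    (s - 1) * (∑ i ∈ range m, (i : A) * s ^ i) = (m : A) - ∑ i ∈ range m, s ^ i := by
  -- `Σ_{j<m+1} j s^j = Σ_{i<m} (i+1) s^{i+1} = D + m s^m = D + m`
  have h1 : ∑ j ∈ range (m + 1), (j : A) * s ^ j =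
      (∑ i ∈ range m, ((i + 1 : ℕ) : A) * s ^ (i + 1)) + ((0 : ℕ) : A) * s ^ 0 :=
    sum_range_succ' (fun j => (j : A) * s ^ j) m
  have h2 : ∑ j ∈ range (m + 1), (j : A) * s ^ j =
      (∑ j ∈ range m, (j : A) * s ^ j) + (m : A) * s ^ m :=
    sum_range_succ (fun j => (j : A) * s ^ j) m
  rw [Nat.cast_zero, zero_mul, add_zero] at h1
  rw [hs, mul_one] at h2
  -- `s · (D + N) = Σ_{i<m} (i+1) s^{i+1}`
  have h3 : s * ((∑ i ∈ range m, (i : A) * s ^ i) + ∑ i ∈ range m, s ^ i) =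
      ∑ i ∈ range m, ((i + 1 : ℕ) : A) * s ^ (i + 1) := by
    rw [← sum_add_distrib, mul_sum]
    refine sum_congr rfl fun i _ => ?_
    rw [Nat.cast_succ, add_mul, one_mul, mul_add, ← mul_assoc, ← Nat.cast_comm, mul_assoc,
      ← pow_succ']
  have h4 : s * (∑ i ∈ range m, (i : A) * s ^ i) + ∑ i ∈ range m, s ^ i =
      (∑ j ∈ range m, (j : A) * s ^ j) + (m : A) := by
    conv_lhs => rw [← mul_norm_eq hs, ← mul_add, h3, ← h1, h2]
  rw [sub_mul, one_mul, sub_eq_sub_iff_add_eq_add, h4, add_comm]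

/-- **`(σ - 1) D = m - N` in the group ring `ℤ[G]`** (Rubin 1999, proof of Prop. 8.4:
*"Note that `(σ_𝔮 - 1)D_𝔮 = N𝔮 - 1 - N_𝔮`"*, in `ℤ[G_𝔮]`, `G_𝔮 = ⟨σ_𝔮⟩` of order `N𝔮 - 1`): for
`σ ∈ G` with `σ^m = 1`, `(σ - 1) · Σ_{i<m} i σ^i = m - Σ_{i<m} σ^i` in `MonoidAlgebra ℤ G`.
[cite: Rubin1999, §8.2, Def. 8.3 and proof of Prop. 8.4] [cite: GrossLMS1991, §3 (3.5)] -/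
theorem of_sub_one_mul_derivative {G : Type*} [Monoid G] (σ : G) {m : ℕ} (hσ : σ ^ m = 1) :
    (MonoidAlgebra.of ℤ G σ - 1) *
        (∑ i ∈ range m, (i : MonoidAlgebra ℤ G) * MonoidAlgebra.of ℤ G (σ ^ i)) =
      (m : MonoidAlgebra ℤ G) - ∑ i ∈ range m, MonoidAlgebra.of ℤ G (σ ^ i) := by
  have hs : (MonoidAlgebra.of ℤ G σ) ^ m = 1 := by rw [← map_pow, hσ, map_one]
  simp_rw [map_pow]
  exact sub_one_mul_derivative hs

end Ring

/-! ### The same on a `G`-module, and the fixedness of `D x` (Prop. 8.4 (ii), one prime) -/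

section Module

variable {G X : Type*} [Monoid G] [AddCommGroup X] [DistribMulAction G X]

/-- `σ · N x = N x` for `N x = Σ_{i<m} σ^i x`, `σ^m = 1`. [cite: Rubin1999, §8.2 (Def. 8.3)] -/
theorem smul_norm_eq (σ : G) {m : ℕ} (hσ : σ ^ m = 1) (x : X) :
    σ • (∑ i ∈ range m, σ ^ i • x) = ∑ i ∈ range m, σ ^ i • x := by
  have h1 : ∑ i ∈ range (m + 1), σ ^ i • x = (∑ i ∈ range m, σ ^ (i + 1) • x) + σ ^ 0 • x :=
    sum_range_succ' (fun i => σ ^ i • x) m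
  have h2 : ∑ i ∈ range (m + 1), σ ^ i • x = (∑ i ∈ range m, σ ^ i • x) + σ ^ m • x :=
    sum_range_succ (fun i => σ ^ i • x) m
  rw [pow_zero] at h1
  rw [hσ] at h2
  have h3 : ∑ i ∈ range m, σ ^ (i + 1) • x = ∑ i ∈ range m, σ ^ i • x :=
    add_right_cancel (h1.symm.trans h2)
  rw [smul_sum]
  simp_rw [smul_smul, ← pow_succ']
  exact h3

/-- `σ^k · N x = N x`: the norm element is fixed by `⟨σ⟩`. [cite: Rubin1999, §8.2 (Def. 8.3)] -/
theorem pow_smul_norm_eq (σ : G) {m : ℕ} (hσ : σ ^ m = 1) (x : X) (k : ℕ) :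
    σ ^ k • (∑ i ∈ range m, σ ^ i • x) = ∑ i ∈ range m, σ ^ i • x := by
  induction k with
  | zero => rw [pow_zero, one_smul]
  | succ k ih => rw [pow_succ, mul_smul, smul_norm_eq σ hσ, ih]

/-- **Kolyvagin's identity on a `G`-module**: for `σ^m = 1` and `D x = Σ_{i<m} i σ^i x`,
`N x = Σ_{i<m} σ^i x`, one has `σ D x - D x = m·x - N x` (Rubin 1999, proof of Prop. 8.4,
applied to `x_{n,𝔯} ∈ X_{n,𝔯}`; Gross 1991 (3.5) applied to `y_n ∈ E(K_n)`).
[cite: Rubin1999, §8.2, proof of Prop. 8.4] [cite: GrossLMS1991, §3 (3.5), Prop. 3.6] -/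
theorem smul_derivative_sub_derivative (σ : G) {m : ℕ} (hσ : σ ^ m = 1) (x : X) :
    σ • (∑ i ∈ range m, i • σ ^ i • x) - ∑ i ∈ range m, i • σ ^ i • x =
      m • x - ∑ i ∈ range m, σ ^ i • x := by
  have h1 : ∑ j ∈ range (m + 1), j • σ ^ j • x =
      (∑ i ∈ range m, (i + 1) • σ ^ (i + 1) • x) + 0 • σ ^ 0 • x :=
    sum_range_succ' (fun j => j • σ ^ j • x) m
  have h2 : ∑ j ∈ range (m + 1), j • σ ^ j • x =
      (∑ j ∈ range m, j • σ ^ j • x) + m • σ ^ m • x :=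
    sum_range_succ (fun j => j • σ ^ j • x) m
  rw [zero_smul, add_zero] at h1
  rw [hσ, one_smul] at h2
  have h3 : σ • ((∑ i ∈ range m, i • σ ^ i • x) + ∑ i ∈ range m, σ ^ i • x) =
      ∑ i ∈ range m, (i + 1) • σ ^ (i + 1) • x := by
    rw [← sum_add_distrib, smul_sum]
    refine sum_congr rfl fun i _ => ?_
    rw [succ_nsmul, smul_add, smul_comm σ i (σ ^ i • x), smul_smul, ← pow_succ']
  have h4 : σ • (∑ i ∈ range m, i • σ ^ i • x) + ∑ i ∈ range m, σ ^ i • x =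
      (∑ j ∈ range m, j • σ ^ j • x) + m • x := by
    conv_lhs => rw [← smul_norm_eq σ hσ x, ← smul_add, h3, ← h1, h2]
  rw [sub_eq_sub_iff_add_eq_add, h4, add_comm]

/-- Powers of `σ` preserve a `σ`-stable subgroup. [folklore] -/
theorem pow_smul_mem_of_smul_mem (σ : G) (S : AddSubgroup X) (hS : ∀ y ∈ S, σ • y ∈ S)
    (k : ℕ) {y : X} (hy : y ∈ S) : σ ^ k • y ∈ S := by
  induction k with
  | zero => rwa [pow_zero, one_smul]
  | succ k ih => rw [pow_succ', mul_smul]; exact hS _ ih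

/-- **Rubin 1999, Prop. 8.4 (ii), one-prime step**: let `σ^m = 1` act on `X` and let `S ≤ X` be
a `σ`-stable subgroup with `m·x ∈ S` (printed: `M ∣ N𝔮 - 1`, `S = M X_{n,𝔯}`) and `N x ∈ S`
(printed: from the relation `N_𝔮 x_{n,𝔮𝔰} = (1 - Frob_𝔮^{-1}) x_{n,𝔰}` and the induction
hypothesis). Then `D x = Σ_{i<m} i σ^i x` is fixed modulo `S` by every power of `σ`:
`σ^k D x - D x ∈ S` (printed: *"`(σ_𝔮 - 1) D_𝔯 x_{n,𝔯} ∈ M X_{n,𝔯}` … Since the `σ_𝔮` generate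
`G_𝔯`, this proves the proposition"*; Gross, Prop. 3.6: `[D_n y_n]` is fixed by `σ_ℓ`).
[cite: Rubin1999, Prop. 8.4 (ii) and proof] [cite: GrossLMS1991, §3 Prop. 3.6 (proof)] -/
theorem pow_smul_derivative_sub_derivative_mem (σ : G) {m : ℕ} (hσ : σ ^ m = 1) (x : X)
    (S : AddSubgroup X) (hS : ∀ y ∈ S, σ • y ∈ S) (hmx : m • x ∈ S)
    (hNx : ∑ i ∈ range m, σ ^ i • x ∈ S) (k : ℕ) :
    σ ^ k • (∑ i ∈ range m, i • σ ^ i • x) - ∑ i ∈ range m, i • σ ^ i • x ∈ S := by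
  have h1 : σ • (∑ i ∈ range m, i • σ ^ i • x) - ∑ i ∈ range m, i • σ ^ i • x ∈ S := by
    rw [smul_derivative_sub_derivative σ hσ x]
    exact S.sub_mem hmx hNx
  induction k with
  | zero => rw [pow_zero, one_smul, sub_self]; exact S.zero_mem
  | succ k ih =>
    have e : σ ^ (k + 1) • (∑ i ∈ range m, i • σ ^ i • x) - ∑ i ∈ range m, i • σ ^ i • x =
        σ ^ k • (σ • (∑ i ∈ range m, i • σ ^ i • x) - ∑ i ∈ range m, i • σ ^ i • x) +
          (σ ^ k • (∑ i ∈ range m, i • σ ^ i • x) - ∑ i ∈ range m, i • σ ^ i • x) := by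
      rw [pow_succ, mul_smul, smul_sub]
      abel
    rw [e]
    exact S.add_mem (pow_smul_mem_of_smul_mem σ S hS k h1) ih

end Module

end Rubin1987

end Literature.NumberTheory.EllipticCurves
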